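import Summits.Ventures.PercRepro2.CaseOneRootsAndOPendant

/-!
# The pendant root-only and roots-and-`o` classes described in `G` (blind cell PercRepro2, p1 g19)

`IsPendantRootsOnlyAt` / `IsPendantRootsAndOAt`: `a₃` is a leaf at `u` through `e₀`, and the other
edges at `u` join the roots (resp. the roots and, once, `o`). In `G − e₀` the neighbour `u` is
root-only, resp. roots-and-`o` (`…restrict`), so the theorems of `CaseOneRootsAndOPendant` apply:
**`zSplitII/zSplitI/jOneOne/rv_of_pendantRootsOnly`** and **`…_of_pendantRootsAndO`**. Own code;
standard axioms.
-/

namespace Summit.Ventures.PercRepro2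

namespace CaseOne

/-! ## The descriptions in `G` -/

section Descriptions
variable {V : Type*} {E : Type*} [DecidableEq E]

/-- **`a₃` pendant at a root-only vertex `u`** (in `G`): `a₃` is a leaf at `u` through `e₀`, every
other edge at `u` joins a root, and the marks are distinct from `u` / `a₃` as the theorems need. -/
structure IsPendantRootsOnlyAt (ends : E → Sym2 V) (a₁ a₂ u a₃ : V) (e₀ : E) : Prop where
  /-- `a₃` is a leaf at `u` -/
  leaf : IsLeafAt ends u a₃ e₀
  /-- every other edge at `u` joins a root -/
  root : ∀ e, u ∈ ends e → e ≠ e₀ → ends e = s(a₁, u) ∨ ends e = s(a₂, u)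
  /-- `a₁ ≠ u` -/
  ne_a1 : a₁ ≠ u
  /-- `a₁ ≠ a₃` -/
  ne_a1' : a₁ ≠ a₃
  /-- `a₂ ≠ a₃` -/
  ne_a2' : a₂ ≠ a₃

/-- **`a₃` pendant at a roots-and-`o` vertex `u`** (in `G`): `a₃` is a leaf at `u` through `e₀`, `u`
has the edge `eo = {o, u}`, and every other edge at `u` joins a root. -/
structure IsPendantRootsAndOAt (ends : E → Sym2 V) (o a₁ a₂ u a₃ : V) (e₀ eo : E) : Prop where
  /-- `a₃` is a leaf at `u` -/
  leaf : IsLeafAt ends u a₃ e₀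
  /-- the `o`-edge at `u` -/
  ends_o : ends eo = s(o, u)
  /-- every other edge at `u` joins a root -/
  root : ∀ e, u ∈ ends e → e ≠ e₀ → e ≠ eo → ends e = s(a₁, u) ∨ ends e = s(a₂, u)
  /-- `o ≠ u` -/
  ne_o : o ≠ u
  /-- `a₁ ≠ u` -/
  ne_a1 : a₁ ≠ u
  /-- `a₂ ≠ u` -/
  ne_a2 : a₂ ≠ u
  /-- `o ≠ a₃` -/
  ne_o' : o ≠ a₃
  /-- `a₁ ≠ a₃` -/
  ne_a1' : a₁ ≠ a₃
  /-- `a₂ ≠ a₃` -/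
  ne_a2' : a₂ ≠ a₃

variable {ends : E → Sym2 V} {o a₁ a₂ u a₃ : V} {e₀ eo : E}

omit [DecidableEq E] in
/-- In `G − e₀` the neighbour `u` is root-only. -/
lemma IsPendantRootsOnlyAt.restrict (h : IsPendantRootsOnlyAt ends a₁ a₂ u a₃ e₀) :
    ∀ e : {e : E // e ≠ e₀}, u ∈ restrictEnds ends e₀ e →
      restrictEnds ends e₀ e = s(a₁, u) ∨ restrictEnds ends e₀ e = s(a₂, u) :=
  fun e he => h.root e.1 he e.2

omit [DecidableEq E] in
/-- The `o`-edge is not the leaf edge. -/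
lemma IsPendantRootsAndOAt.eo_ne (h : IsPendantRootsAndOAt ends o a₁ a₂ u a₃ e₀ eo) : eo ≠ e₀ := by
  rintro rfl
  have he := h.ends_o
  rw [h.leaf.ends_eq] at he
  rcases Sym2.eq_iff.1 he with ⟨h', _⟩ | ⟨_, h'⟩
  · exact h.ne_o h'.symm
  · exact h.ne_o' h'.symm

omit [DecidableEq E] in
/-- In `G − e₀` the neighbour `u` is roots-and-`o`: the other edges at `u` join a root. -/
lemma IsPendantRootsAndOAt.restrict (h : IsPendantRootsAndOAt ends o a₁ a₂ u a₃ e₀ eo) :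
    ∀ e : {e : E // e ≠ e₀}, u ∈ restrictEnds ends e₀ e → e ≠ ⟨eo, h.eo_ne⟩ →
      restrictEnds ends e₀ e = s(a₁, u) ∨ restrictEnds ends e₀ e = s(a₂, u) :=
  fun e he hne => h.root e.1 he e.2 fun h' => hne (Subtype.ext h')

end Descriptions

section InG
variable {V : Type*} {E : Type*} [Fintype E] [DecidableEq E] [Fintype V] [DecidableEq V]
  {R : Type*} [Field R] [LinearOrder R] [IsStrictOrderedRing R]
variable {ends : E → Sym2 V} {o a₁ a₂ b u a₃ : V} {e₀ eo : E}

/-- **`(ii)` for `a₃` pendant at a root-only vertex, in `G`.** -/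
theorem zSplitII_of_pendantRootsOnly (p : E → R) (hp : IsProbVec p)
    (h : IsPendantRootsOnlyAt ends a₁ a₂ u a₃ e₀) (ho : o ≠ a₃) (hb : b ≠ a₃) :
    ZSplitII p ends o a₁ a₂ a₃ b :=
  zSplitII_of_leaf_rootsOnly p hp h.leaf ho h.ne_a1' h.ne_a2' hb h.restrict h.ne_a1

/-- **`(i)` for `a₃` pendant at a root-only vertex, in `G`.** -/
theorem zSplitI_of_pendantRootsOnly (p : E → R) (hp : IsProbVec p)
    (h : IsPendantRootsOnlyAt ends a₁ a₂ u a₃ e₀) (ho : o ≠ a₃) (hb : b ≠ a₃) (hub : b ≠ u) :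
    ZSplitI p ends o a₁ a₂ a₃ b :=
  zSplitI_of_leaf_rootsOnly p hp h.leaf ho h.ne_a1' h.ne_a2' hb h.restrict h.ne_a1 hub

/-- **`(J1₁)` for `a₃` pendant at a root-only vertex, in `G`.** -/
theorem jOneOne_of_pendantRootsOnly (p : E → R) (hp : IsProbVec p)
    (h : IsPendantRootsOnlyAt ends a₁ a₂ u a₃ e₀) (ho : o ≠ a₃) (hb : b ≠ a₃) (hub : b ≠ u) :
    JOneOne p ends o a₁ a₂ a₃ b :=
  jOneOne_of_leaf_rootsOnly p hp h.leaf ho h.ne_a1' h.ne_a2' hb h.restrict h.ne_a1 hub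

/-- **`(RV)` for `a₃` pendant at a root-only vertex, in `G`** (when `T′` has mass). -/
theorem rv_of_pendantRootsOnly (p : E → R) (hp : IsProbVec p)
    (h : IsPendantRootsOnlyAt ends a₁ a₂ u a₃ e₀) (ho : o ≠ a₃) (hb : b ≠ a₃)
    (hT : 0 < prob p (Tp ends a₁ a₂ a₃)) : RV p ends o a₁ a₂ a₃ b :=
  (rv_iff_ii p ends o a₁ a₂ a₃ b hT).2 (zSplitII_of_pendantRootsOnly p hp h ho hb)

/-- **`(ii)` for `a₃` pendant at a roots-and-`o` vertex, in `G`.** -/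
theorem zSplitII_of_pendantRootsAndO (p : E → R) (hp : IsProbVec p)
    (h : IsPendantRootsAndOAt ends o a₁ a₂ u a₃ e₀ eo) (hb : b ≠ a₃) (hub : b ≠ u) :
    ZSplitII p ends o a₁ a₂ a₃ b :=
  zSplitII_of_leaf_rootsAndO p hp h.leaf h.ne_o' h.ne_a1' h.ne_a2' hb (eo := ⟨eo, h.eo_ne⟩)
    h.ends_o h.restrict h.ne_o h.ne_a1 h.ne_a2 hub

/-- **`(i)` for `a₃` pendant at a roots-and-`o` vertex, in `G`.** -/
theorem zSplitI_of_pendantRootsAndO (p : E → R) (hp : IsProbVec p)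
    (h : IsPendantRootsAndOAt ends o a₁ a₂ u a₃ e₀ eo) (hb : b ≠ a₃) (hub : b ≠ u) :
    ZSplitI p ends o a₁ a₂ a₃ b :=
  zSplitI_of_leaf_rootsAndO p hp h.leaf h.ne_o' h.ne_a1' h.ne_a2' hb (eo := ⟨eo, h.eo_ne⟩)
    h.ends_o h.restrict h.ne_o h.ne_a1 hub

/-- **`(J1₁)` for `a₃` pendant at a roots-and-`o` vertex, in `G`.** -/
theorem jOneOne_of_pendantRootsAndO (p : E → R) (hp : IsProbVec p)
    (h : IsPendantRootsAndOAt ends o a₁ a₂ u a₃ e₀ eo) (hb : b ≠ a₃) (hub : b ≠ u) :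
    JOneOne p ends o a₁ a₂ a₃ b :=
  jOneOne_of_i_of_ii p ends o a₁ a₂ a₃ b (zSplitI_of_pendantRootsAndO p hp h hb hub)
    (zSplitII_of_pendantRootsAndO p hp h hb hub)

/-- **`(RV)` for `a₃` pendant at a roots-and-`o` vertex, in `G`** (when `T′` has mass). -/
theorem rv_of_pendantRootsAndO (p : E → R) (hp : IsProbVec p)
    (h : IsPendantRootsAndOAt ends o a₁ a₂ u a₃ e₀ eo) (hb : b ≠ a₃) (hub : b ≠ u)
    (hT : 0 < prob p (Tp ends a₁ a₂ a₃)) : RV p ends o a₁ a₂ a₃ b :=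
  (rv_iff_ii p ends o a₁ a₂ a₃ b hT).2 (zSplitII_of_pendantRootsAndO p hp h hb hub)

end InG

end CaseOne

end Summit.Ventures.PercRepro2
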